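import Mathlib

/-!
# Generic leaf-nondegeneracy (stub B of crux `WindLine.WindyGalerkinSteadyZerothLaw`,
# stmt-AnomalousDissipation-11414), tools K: the finite-dimensional Sard step for a parametrised
# submersion (Smale 1965 / Foias–Temam 1976, local form)

Helper layer (pure proof file, no definitions).  Abstract setting: `X` a real Banach space, `Γ` a
finite-dimensional real normed space (the parameters), `Ψ : X × Γ → X` strictly differentiable with
derivative `Ψ'(z)(ξ, η) = T(z.1) ξ − F η` depending continuously on `z`, and an open set `𝒪` on
which `Ψ'(z)` is onto (transversality).  At a point `z₀ ∈ 𝒪` where `ker Ψ'(z₀)` is finite-dimensional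
of dimension `dim Γ` (index zero), the implicit function theorem
(`HasStrictFDerivAt.implicitToOpenPartialHomeomorphOfComplemented`) straightens the zero set of `Ψ`
near `z₀` into a graph over `ker Ψ'(z₀) ≅ Γ`; on that chart, a zero `(x, γ)` of `Ψ` with `T x` NOT
onto is a critical point of the parameter projection (`surjective_of_surjective_chart`), so by Sard's
theorem in `Γ` (Mathlib's `MeasureTheory.addHaar_image_eq_zero_of_det_fderivWithin_eq_zero`) the
parameters of such zeros near `z₀` form a null set (`exists_chart_null`).  A countable union over a
second-countable `X` and the positivity of Haar measure on balls then give, for any set of zeros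
covered by such points, arbitrarily small parameters all of whose zeros have `T x` onto
(`exists_small_regular_parameter`).

References: S. Smale, *An infinite dimensional version of Sard's theorem*, Amer. J. Math. 87 (1965)
861–866, Thm. 1.3; C. Foias, R. Temam, LNM 565 (1976), p. 26 (finite-mode Sard argument);
J.-C. Saut, R. Temam, Comm. PDE 4 (1979) 293–319, §2.
-/

noncomputable section

-- D-0017: single-problem summit ⇒ the duplicated namespace segment is by design.
set_option linter.dupNamespace false

open scoped Topology NNReal ENNReal
open Filter Set Function MeasureTheory

namespace Summit.AnomalousDissipation.AnomalousDissipation.Theorems.WindLineWindyGalerkinSteadyZerothLaw.GenericLeaf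

section SardStep

variable {X Γ : Type*} [NormedAddCommGroup X] [NormedSpace ℝ X] [CompleteSpace X]
  [NormedAddCommGroup Γ] [NormedSpace ℝ Γ] [FiniteDimensional ℝ Γ]

/-! ## §1 Two pieces of linear algebra -/

omit [CompleteSpace X] [FiniteDimensional ℝ Γ] in
/-- **Regular points of the parameter projection have `T x` onto.**  Let `Ψz(ξ, η) = Tx ξ − F η` be
onto and let `M : X × Γ ≃ X × G` be an isomorphism with first component `Ψz`.  If
`ω ↦ (M⁻¹(0, ω)).2 : G → Γ` is onto, then `Tx` is onto (`range F ⊆ range Tx` and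
`range Tx + range F = X`). [folklore] -/
theorem surjective_of_surjective_chart {G : Type*} [NormedAddCommGroup G] [NormedSpace ℝ G]
    (Ψz : (X × Γ) →L[ℝ] X) (Tx : X →L[ℝ] X) (F : Γ →L[ℝ] X) (hΨz : ∀ ζ, Ψz ζ = Tx ζ.1 - F ζ.2)
    (hsurjΨ : Function.Surjective Ψz) (M : (X × Γ) ≃L[ℝ] (X × G)) (hM : ∀ ζ, (M ζ).1 = Ψz ζ)
    (h : Function.Surjective (fun ω : G => (M.symm (0, ω)).2)) : Function.Surjective Tx := by
  have hF : ∀ b : Γ, ∃ ξ : X, Tx ξ = F b := by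
    intro b
    obtain ⟨ω, hω⟩ := h b
    set ζ := M.symm (0, ω) with hζ
    have h1 : (M ζ).1 = 0 := by rw [hζ, ContinuousLinearEquiv.apply_symm_apply]
    rw [hM, hΨz, sub_eq_zero] at h1
    refine ⟨ζ.1, ?_⟩
    rw [h1]
    exact congrArg F hω
  intro y
  obtain ⟨⟨a, b⟩, hab⟩ := hsurjΨ y
  rw [hΨz] at hab
  obtain ⟨ξ, hξ⟩ := hF b
  refine ⟨a - ξ, ?_⟩
  rw [map_sub, hξ]
  exact hab

omit [CompleteSpace X] in
/-- A non-surjective endomorphism of a finite-dimensional space has determinant zero. [folklore] -/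
theorem det_eq_zero_of_not_surjective (f : Γ →L[ℝ] Γ) (h : ¬ Function.Surjective f) : f.det = 0 := by
  by_contra hd
  have hu : IsUnit (LinearMap.det (f : Γ →ₗ[ℝ] Γ)) := isUnit_iff_ne_zero.2 hd
  have hu' : IsUnit (f : Γ →ₗ[ℝ] Γ) := (LinearMap.isUnit_iff_isUnit_det _).2 hu
  exact h ((Module.End.isUnit_iff _).1 hu').2

/-! ## §2 The chart lemma -/

/-- **The chart lemma (local Sard step).**  See the module docstring.  Around a transversal point `z₀`
of index zero there is an open set `O ∋ z₀` such that the parameters `γ` of zeros `(x, γ) ∈ O` of `Ψ`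
with `T x` not onto form a `μ`-null set, for any additive Haar measure `μ` on `Γ`. [folklore] -/
theorem exists_chart_null [MeasurableSpace Γ] [BorelSpace Γ] (μ : Measure Γ) [μ.IsAddHaarMeasure]
    (Ψ : X × Γ → X) (Ψ' : X × Γ → ((X × Γ) →L[ℝ] X)) (hΨ : ∀ z, HasStrictFDerivAt Ψ (Ψ' z) z)
    (hΨ'c : Continuous Ψ') (T : X → (X →L[ℝ] X)) (F : Γ →L[ℝ] X) (hΨ' : ∀ z ζ, Ψ' z ζ = T z.1 ζ.1 - F ζ.2)
    (𝒪 : Set (X × Γ)) (h𝒪 : IsOpen 𝒪) (hsurj : ∀ z ∈ 𝒪, Function.Surjective (Ψ' z))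
    (z₀ : X × Γ) (hz₀ : z₀ ∈ 𝒪) [FiniteDimensional ℝ (LinearMap.ker (Ψ' z₀ : (X × Γ) →ₗ[ℝ] X))]
    (hdim : Module.finrank ℝ (LinearMap.ker (Ψ' z₀ : (X × Γ) →ₗ[ℝ] X)) = Module.finrank ℝ Γ) :
    ∃ O : Set (X × Γ), IsOpen O ∧ z₀ ∈ O ∧
      μ {γ : Γ | ∃ x : X, (x, γ) ∈ O ∧ Ψ (x, γ) = 0 ∧ ¬ Function.Surjective (T x)} = 0 := by
  set f' : (X × Γ) →L[ℝ] X := Ψ' z₀ with hf'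
  have hrange : (f' : (X × Γ) →ₗ[ℝ] X).range = ⊤ := LinearMap.range_eq_top.2 (hsurj z₀ hz₀)
  have hkc : (f' : (X × Γ) →ₗ[ℝ] X).ker.ClosedComplemented := Submodule.ClosedComplemented.of_finiteDimensional _
  set G := (LinearMap.ker (f' : (X × Γ) →ₗ[ℝ] X)) with hG
  -- the chart `Θ y = (Ψ y, p (y - z₀))`
  set Θ := (hΨ z₀).implicitToOpenPartialHomeomorphOfComplemented Ψ f' hrange hkc with hΘ
  set p : (X × Γ) →L[ℝ] G := Classical.choose hkc with hp
  have hpk : ∀ k : G, p k = k := Classical.choose_spec hkc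
  have hΘy : ∀ y, Θ y = (Ψ y, p (y - z₀)) := fun y =>
    (hΨ z₀).implicitToOpenPartialHomeomorphOfComplemented_apply hrange hkc y
  -- its derivative `DΘ y = (Ψ' y, p)` everywhere
  set DΘ : X × Γ → ((X × Γ) →L[ℝ] (X × G)) := fun y => (Ψ' y).prod p with hDΘ
  have hDΘy : ∀ y, HasStrictFDerivAt Θ (DΘ y) y := by
    intro y
    have e : (Θ : X × Γ → X × G) = fun y => (Ψ y, p (y - z₀)) := funext hΘy
    rw [e]
    exact (hΨ y).prodMk (p.hasStrictFDerivAt.comp y ((hasStrictFDerivAt_id y).sub_const z₀))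
  have hDΘc : Continuous DΘ :=
    (ContinuousLinearMap.prodL ℝ).continuous.comp (hΨ'c.prodMk continuous_const)
  -- invertibility of `DΘ` is open and holds at `z₀`
  set Inv : Set (X × Γ) := {y | DΘ y ∈ Set.range (ContinuousLinearEquiv.toContinuousLinearMap :
    ((X × Γ) ≃L[ℝ] (X × G)) → ((X × Γ) →L[ℝ] (X × G)))} with hInv
  have hInvo : IsOpen Inv := ContinuousLinearEquiv.isOpen.preimage hDΘc
  have hpr : (p : (X × Γ) →ₗ[ℝ] G).range = ⊤ := LinearMap.range_eq_of_proj hpk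
  have hpc : IsCompl (f' : (X × Γ) →ₗ[ℝ] X).ker (p : (X × Γ) →ₗ[ℝ] G).ker := LinearMap.isCompl_of_proj hpk
  set M₀ : (X × Γ) ≃L[ℝ] (X × G) := f'.equivProdOfSurjectiveOfIsCompl p hrange hpr hpc with hM₀
  haveI : Nonempty ((X × Γ) ≃L[ℝ] (X × G)) := ⟨M₀⟩
  have hz₀Inv : z₀ ∈ Inv := by
    refine ⟨M₀, ContinuousLinearMap.ext fun ζ => ?_⟩
    rw [ContinuousLinearEquiv.coe_coe, hM₀, ContinuousLinearMap.equivProdOfSurjectiveOfIsCompl_apply]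
    rfl
  -- the open set
  set O : Set (X × Γ) := Θ.source ∩ Inv ∩ 𝒪 with hO
  refine ⟨O, (Θ.open_source.inter hInvo).inter h𝒪,
    ⟨⟨(hΨ z₀).mem_implicitToOpenPartialHomeomorphOfComplemented_source hrange hkc, hz₀Inv⟩, hz₀⟩, ?_⟩
  -- the chart parametrisation of the zero set: `g w = Θ⁻¹(0, w)`, `h w = (g w).2`
  set g : G → X × Γ := fun w => Θ.symm (0, w) with hg
  set Vc : Set G := {w | ((0 : X), w) ∈ Θ.target ∧ g w ∈ O ∧ ¬ Function.Surjective (T (g w).1)} with hVc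
  -- the bad parameters are covered by `h(Vc)`
  have hcover : {γ : Γ | ∃ x : X, (x, γ) ∈ O ∧ Ψ (x, γ) = 0 ∧ ¬ Function.Surjective (T x)} ⊆
      (fun w => (g w).2) '' Vc := by
    rintro γ ⟨x, hxO, hΨ0, hT⟩
    have hsrc : (x, γ) ∈ Θ.source := hxO.1.1
    set w : G := (Θ (x, γ)).2 with hw
    have hΘz : Θ (x, γ) = (0, w) := by
      rw [hw]; ext1
      · rw [hΘy]; exact hΨ0
      · rfl
    have hgw : g w = (x, γ) := by rw [hg]; dsimp only; rw [← hΘz, Θ.left_inv hsrc]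
    refine ⟨w, ⟨by rw [← hΘz]; exact Θ.map_source hsrc, by rw [hgw]; exact hxO, by rw [hgw]; exact hT⟩, ?_⟩
    change (g w).2 = γ
    rw [hgw]
  -- derivatives of the chart on `Vc`
  have hderiv : ∀ w ∈ Vc, ∃ Mz : (X × Γ) ≃L[ℝ] (X × G), (∀ ζ, (Mz ζ).1 = Ψ' (g w) ζ) ∧
      HasFDerivAt (fun w => (g w).2) ((ContinuousLinearMap.snd ℝ X Γ).comp
        ((Mz.symm : (X × G) →L[ℝ] (X × Γ)).comp ((0 : G →L[ℝ] X).prod (ContinuousLinearMap.id ℝ G)))) w := by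
    intro w hw
    obtain ⟨Mz, hMz⟩ := hw.2.1.1.2
    refine ⟨Mz, fun ζ => by rw [← ContinuousLinearEquiv.coe_coe Mz, hMz]; rfl, ?_⟩
    have h1 : HasFDerivAt Θ (Mz : (X × Γ) →L[ℝ] (X × G)) (Θ.symm (0, w)) := by
      rw [hMz]; exact (hDΘy _).hasFDerivAt
    have h2 : HasFDerivAt Θ.symm (Mz.symm : (X × G) →L[ℝ] (X × Γ)) (0, w) := Θ.hasFDerivAt_symm hw.1 h1
    have h3 : HasFDerivAt (fun w : G => ((0 : X), w)) ((0 : G →L[ℝ] X).prod (ContinuousLinearMap.id ℝ G)) w :=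
      (hasFDerivAt_const (0 : X) w).prodMk (hasFDerivAt_id w)
    exact hasFDerivAt_snd.comp w (h2.comp w h3)
  choose! Mz hMz1 hMz2 using hderiv
  -- on `Vc` the derivative of `h` is not onto
  have hnotsurj : ∀ w ∈ Vc, ¬ Function.Surjective ((ContinuousLinearMap.snd ℝ X Γ).comp
      ((Mz w).symm.toContinuousLinearMap.comp ((0 : G →L[ℝ] X).prod (ContinuousLinearMap.id ℝ G)))) := by
    intro w hw hs
    refine hw.2.2 (surjective_of_surjective_chart (Ψ' (g w)) (T (g w).1) F (hΨ' (g w)) (hsurj _ hw.2.1.2)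
      (Mz w) (hMz1 w hw) ?_)
    intro η
    obtain ⟨ω, hω⟩ := hs η
    exact ⟨ω, hω⟩
  -- transport to `Γ` and apply Sard
  set L : Γ ≃L[ℝ] G := ContinuousLinearEquiv.ofFinrankEq hdim.symm with hL
  set fΓ : Γ → Γ := fun γ => (g (L γ)).2 with hfΓ
  set s : Set Γ := L ⁻¹' Vc with hs
  set fΓ' : Γ → (Γ →L[ℝ] Γ) := fun γ => ((ContinuousLinearMap.snd ℝ X Γ).comp
    ((Mz (L γ)).symm.toContinuousLinearMap.comp ((0 : G →L[ℝ] X).prod (ContinuousLinearMap.id ℝ G)))).comp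
      (L : Γ →L[ℝ] G) with hfΓ'
  have hfd : ∀ γ ∈ s, HasFDerivWithinAt fΓ (fΓ' γ) s γ := fun γ hγ =>
    ((hMz2 (L γ) hγ).comp γ L.hasFDerivAt).hasFDerivWithinAt
  have hdet : ∀ γ ∈ s, (fΓ' γ).det = 0 := by
    intro γ hγ
    refine det_eq_zero_of_not_surjective _ fun hsj => hnotsurj (L γ) hγ ?_
    intro η
    obtain ⟨γ', hγ'⟩ := hsj η
    exact ⟨L γ', hγ'⟩
  have hnull : μ (fΓ '' s) = 0 := addHaar_image_eq_zero_of_det_fderivWithin_eq_zero μ hfd hdet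
  have himg : (fun w => (g w).2) '' Vc ⊆ fΓ '' s := by
    rintro _ ⟨w, hw, rfl⟩
    refine ⟨L.symm w, ?_, ?_⟩
    · change L (L.symm w) ∈ Vc
      rw [ContinuousLinearEquiv.apply_symm_apply]; exact hw
    · change (g (L (L.symm w))).2 = (g w).2
      rw [ContinuousLinearEquiv.apply_symm_apply]
  exact measure_mono_null (hcover.trans himg) hnull

/-! ## §3 Countably many charts: small regular parameters -/

/-- **Small regular parameters** (Smale–Sard, finite-dimensional form).  With `Ψ`, `T`, `F`, `𝒪` as
in `exists_chart_null` and `X` second countable: if every point of a set `Z₀ ⊆ 𝒪` has index zero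
(`ker Ψ'(z)` finite-dimensional of dimension `dim Γ`), then for every `ε > 0` there is a parameter
`γ` with `‖γ‖ < ε` such that every zero `(x, γ) ∈ Z₀` of `Ψ` has `T x` onto.  (Countably many charts
cover `Z₀`; the bad parameters are Haar-null, and balls have positive Haar measure.) [folklore] -/
theorem exists_small_regular_parameter [SecondCountableTopology X]
    (Ψ : X × Γ → X) (Ψ' : X × Γ → ((X × Γ) →L[ℝ] X)) (hΨ : ∀ z, HasStrictFDerivAt Ψ (Ψ' z) z)
    (hΨ'c : Continuous Ψ') (T : X → (X →L[ℝ] X)) (F : Γ →L[ℝ] X) (hΨ' : ∀ z ζ, Ψ' z ζ = T z.1 ζ.1 - F ζ.2)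
    (𝒪 : Set (X × Γ)) (h𝒪 : IsOpen 𝒪) (hsurj : ∀ z ∈ 𝒪, Function.Surjective (Ψ' z))
    (Z₀ : Set (X × Γ)) (hZ₀ : Z₀ ⊆ 𝒪)
    (hfd : ∀ z ∈ Z₀, FiniteDimensional ℝ (LinearMap.ker (Ψ' z : (X × Γ) →ₗ[ℝ] X)))
    (hdim : ∀ z ∈ Z₀, Module.finrank ℝ (LinearMap.ker (Ψ' z : (X × Γ) →ₗ[ℝ] X)) = Module.finrank ℝ Γ)
    {ε : ℝ} (hε : 0 < ε) :
    ∃ γ : Γ, ‖γ‖ < ε ∧ ∀ x : X, (x, γ) ∈ Z₀ → Ψ (x, γ) = 0 → Function.Surjective (T x) := by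
  letI : MeasurableSpace Γ := borel Γ
  haveI : BorelSpace Γ := ⟨rfl⟩
  set μ : Measure Γ := Measure.addHaar with hμ
  -- charts
  have hchart : ∀ z ∈ Z₀, ∃ O : Set (X × Γ), IsOpen O ∧ z ∈ O ∧
      μ {γ : Γ | ∃ x : X, (x, γ) ∈ O ∧ Ψ (x, γ) = 0 ∧ ¬ Function.Surjective (T x)} = 0 := by
    intro z hz
    haveI := hfd z hz
    exact exists_chart_null μ Ψ Ψ' hΨ hΨ'c T F hΨ' 𝒪 h𝒪 hsurj z (hZ₀ hz) (hdim z hz)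
  choose! O hOo hzO hOnull using hchart
  -- a countable subcover
  obtain ⟨Tc, hTc, hTU⟩ := TopologicalSpace.isOpen_iUnion_countable (fun z : Z₀ => O z) fun z => hOo z z.2
  set K : Set Γ := {γ | ∃ x : X, (x, γ) ∈ Z₀ ∧ Ψ (x, γ) = 0 ∧ ¬ Function.Surjective (T x)} with hK
  have hKsub : K ⊆ ⋃ i ∈ Tc, {γ : Γ | ∃ x : X, (x, γ) ∈ O i ∧ Ψ (x, γ) = 0 ∧ ¬ Function.Surjective (T x)} := by
    rintro γ ⟨x, hxZ, hΨ0, hT⟩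
    have hmem : (x, γ) ∈ ⋃ i : Z₀, O i := mem_iUnion.2 ⟨⟨(x, γ), hxZ⟩, hzO _ hxZ⟩
    rw [← hTU] at hmem
    obtain ⟨i, hi, hxi⟩ := mem_iUnion₂.1 hmem
    exact mem_iUnion₂.2 ⟨i, hi, x, hxi, hΨ0, hT⟩
  have hKnull : μ K = 0 := by
    refine measure_mono_null hKsub ((measure_biUnion_null_iff hTc).2 fun i _ => hOnull i i.2)
  -- a ball has positive measure
  have hball : 0 < μ (Metric.ball (0 : Γ) ε) := Metric.isOpen_ball.measure_pos μ ⟨0, Metric.mem_ball_self hε⟩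
  have hnot : ¬ Metric.ball (0 : Γ) ε ⊆ K := fun hsub =>
    absurd (hball.trans_le ((measure_mono hsub).trans (le_of_eq hKnull))) (lt_irrefl _)
  obtain ⟨γ, hγ, hγK⟩ := not_subset.1 hnot
  refine ⟨γ, by simpa using hγ, fun x hxZ hΨ0 => ?_⟩
  by_contra hT
  exact hγK ⟨x, hxZ, hΨ0, hT⟩

end SardStep

/-! ## §4 Registered sub-goal -/

/-- **Registered sub-goal `genericLeaf_toolsK`** (worker B of stub `stub_genericLeafNondegeneracy`): the
finite-dimensional Smale–Sard step `exists_small_regular_parameter` in Pi-form. [folklore] -/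
theorem genericLeaf_toolsK : ∀ {X Γ : Type*} [NormedAddCommGroup X] [NormedSpace ℝ X] [CompleteSpace X] [NormedAddCommGroup Γ] [NormedSpace ℝ Γ] [FiniteDimensional ℝ Γ] [SecondCountableTopology X] (Ψ : X × Γ → X) (Ψ' : X × Γ → ((X × Γ) →L[ℝ] X)), (∀ z, HasStrictFDerivAt Ψ (Ψ' z) z) → Continuous Ψ' → ∀ (T : X → (X →L[ℝ] X)) (F : Γ →L[ℝ] X), (∀ z ζ, Ψ' z ζ = T z.1 ζ.1 - F ζ.2) → ∀ (𝒪 : Set (X × Γ)), IsOpen 𝒪 → (∀ z ∈ 𝒪, Function.Surjective (Ψ' z)) → ∀ (Z₀ : Set (X × Γ)), Z₀ ⊆ 𝒪 → (∀ z ∈ Z₀, FiniteDimensional ℝ (LinearMap.ker (Ψ' z : (X × Γ) →ₗ[ℝ] X))) → (∀ z ∈ Z₀, Module.finrank ℝ (LinearMap.ker (Ψ' z : (X × Γ) →ₗ[ℝ] X)) = Module.finrank ℝ Γ) → ∀ {ε : ℝ}, 0 < ε → ∃ γ : Γ, ‖γ‖ < ε ∧ ∀ x : X, (x, γ) ∈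 Z₀ → Ψ (x, γ) = 0 → Function.Surjective (T x) :=
  fun Ψ Ψ' hΨ hΨ'c T F hΨ' 𝒪 h𝒪 hsurj Z₀ hZ₀ hfd hdim _ hε =>
    exists_small_regular_parameter Ψ Ψ' hΨ hΨ'c T F hΨ' 𝒪 h𝒪 hsurj Z₀ hZ₀ hfd hdim hε

end Summit.AnomalousDissipation.AnomalousDissipation.Theorems.WindLineWindyGalerkinSteadyZerothLaw.GenericLeaf

end
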